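import Mathlib
import Literature.NumberTheory.Automorphic.CocompactHaarModel
import Literature.NumberTheory.Automorphic.ToricPseudoEisensteinCosetUnfolding
import HarnessLib

/-!
# Vectors orthogonal to all toric pseudo-Eisenstein series have vanishing toric periods

Topic `NumberTheory/Automorphic`; namespace `Literature.NumberTheory.Automorphic.RegularRep`
(continuing `QuotientRegularRepresentation`, `CocompactHaarModel`).

The coset-space (`L²(G ⧸ Γ)`, cocompact Haar model) form of the annihilation consequence of the
unwinding adjunction [Garrett2018, §1.8; MoeglinWaldspurger1995, II.1.12]: if a continuous function
`x` on the compact quotient `G ⧸ Γ` is `L²(μQ)`-orthogonal to every pseudo-Eisenstein vector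
`E^χ_f`, `f ∈ C_c(G)`, then the `β conj χ`-weighted toric period of EVERY right translate of `x`
vanishes (`toricCoeff_eq_zero_of_orthogonal_EisL2`, `…_smul`), and consequently any functional on
`C(G ⧸ Γ, ℂ)` that agrees with that weighted period kills all translates (`unfold_of_periodModel`,
`toricPeriodCLM_transl_eq_zero`). Ingredients: `conj_inner_EisL2_toLp` (the pairing as an
integral), `KernelModel.unfolding_theta_quotient` (unwinding on the coset space) and the
fundamental lemma `PseudoEisenstein.eq_zero_of_forall_integral_mul_eq_zero`.

Provenance: HodgeCM PerL cell `pub-hodgecm`, package file `HodgeCM/Automorphic/UnfoldAnnihilation.lean`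
§4 (seat pv15-g2, gate run 24); ported to the tree under the LEAN-IN-TREE rule by seat pv15-g7
(names `HodgeCM.RegularRep.X` ↦ `Literature.NumberTheory.Automorphic.RegularRep.X`, statements
verbatim; the first proof now invokes the tree's fundamental lemma
`PseudoEisenstein.eq_zero_of_forall_integral_mul_eq_zero` in place of the package-internal
`PerL34.Vanishing.toricCoeff_eq_zero_of_forall_test_haar`).

## References

* P. Garrett, *Modern Analysis of Automorphic Forms by Example*, vol. 1 (2018), §1.8 [Garrett2018].
* C. Mœglin, J.-L. Waldspurger, *Spectral Decomposition and Eisenstein Series* (1995), II.1.12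
  [MoeglinWaldspurger1995].
-/

noncomputable section

open _root_.MeasureTheory Set Filter Function
open scoped InnerProductSpace ENNReal ComplexConjugate CompactlySupported

namespace Literature.NumberTheory.Automorphic

namespace RegularRep

open Literature.NumberTheory.Automorphic.PseudoEisenstein

section Unfold

variable {G : Type*} [Group G] [TopologicalSpace G] [IsTopologicalGroup G] [T2Space G]
  [LocallyCompactSpace G] [MeasurableSpace G] [BorelSpace G]
  {Γ : Subgroup G} [MeasurableSpace (G ⧸ Γ)] [BorelSpace (G ⧸ Γ)] [T2Space (G ⧸ Γ)]
  [CompactSpace (G ⧸ Γ)]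
  {μQ : Measure (G ⧸ Γ)} [IsFiniteMeasure μQ]
  {T : Type*} [Group T] [TopologicalSpace T] [T2Space T] [MeasurableSpace T] [OpensMeasurableSpace T]
  (ν : Measure T) [IsFiniteMeasureOnCompacts ν] (jT : ContinuousMonoidHom T G) (β : C_c(T, ℝ))
  (χ : C(T, ℂ))

/-- **Annihilation on the coset space.** In the cocompact Haar model, if the continuous function
`x` on `G ⧸ Γ` is `L²(μQ)`-orthogonal to every pseudo-Eisenstein vector `E^χ_f`, `f ∈ C_c(G)`, then
for EVERY `h ∈ G` the `β conj χ`-weighted toric period of the right translate vanishes: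
`∫_T β(t) conj χ(t) · x(π((jT t · h)⁻¹)) dν(t) = 0`.
[cite: MoeglinWaldspurger1995, II.1.12] -/
theorem toricCoeff_eq_zero_of_orthogonal_EisL2 {μ : Measure G} (hM : IsCocompactHaarModel Γ μQ μ)
    (hΓ : DiscreteMeets Γ) (x : C(G ⧸ Γ, ℂ))
    (horth : ∀ f : C_c(G, ℂ), ⟪EisL2 μQ ν jT β χ hΓ f, ContinuousMap.toLp (E := ℂ) 2 μQ ℂ x⟫_ℂ = 0) (h : G) :
    ∫ t, wt β (star χ) t * x (QuotientGroup.mk (jT t * h)⁻¹) ∂ν = 0 := by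
  obtain ⟨𝓕, h𝓕, hμQ⟩ := hM.exists_fundamentalDomain
  haveI := hM.isHaar
  haveI := hM.regular
  haveI := hM.rightInvariant
  haveI := hM.countable
  -- the test vector `v(y) := x(π(y⁻¹))` on `G` and the weight `w := β conj χ`
  have hvc : Continuous fun y : G => x (QuotientGroup.mk y⁻¹) :=
    x.continuous.comp (QuotientGroup.continuous_mk.comp continuous_inv)
  -- the weighted toric coefficient `P(y) := ∫ β conj χ · x(π((jT t · y)⁻¹)) dν` is continuous in `y`
  have hPc : Continuous fun y : G =>
      ∫ t, wt β (star χ) t * x (QuotientGroup.mk (jT t * y)⁻¹) ∂ν := by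
    have hc := continuous_toricPeriod_conj ν jT.toMonoidHom jT.continuous β β.continuous
      β.hasCompactSupport χ χ.continuous (fun y : G => x (QuotientGroup.mk y⁻¹)) hvc
    exact hc.congr fun y => rfl
  -- fundamental lemma: `conj P` integrates to zero against every test function, hence `P = 0`
  suffices hP0 : (fun y : G =>
      conj (∫ t, wt β (star χ) t * x (QuotientGroup.mk (jT t * y)⁻¹) ∂ν)) = 0 by
    simpa only [Pi.zero_apply, map_eq_zero] using congrFun hP0 h
  refine eq_zero_of_forall_integral_mul_eq_zero μ _ (Complex.continuous_conj.comp hPc) ?_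
  intro f hf hfs
  -- `conj ⟪E^χ_f, x⟫ = 0`, written as an integral over `G ⧸ Γ`
  have h0 : ∫ q, conj (x q) * EisQ Γ ν jT.toMonoidHom β χ f q ∂μQ = 0 := by
    have h1 := congrArg conj (horth ⟨⟨f, hf⟩, hfs⟩)
    rw [map_zero, conj_inner_EisL2_toLp] at h1
    exact h1
  -- unwind on the coset space with the kernel `θ_y := y`, `ω(h) y := y (h⁻¹ • ·)`, at `y := conj x`
  have hunf := KernelModel.unfolding_theta_quotient μ ν jT.toMonoidHom jT.continuous β β.continuous
    β.hasCompactSupport χ χ.continuous hΓ 𝓕 h𝓕 hμQ f hf hfs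
    (X := G ⧸ Γ → ℂ) (fun y q => y q) (fun g y q => y (g⁻¹ • q)) (fun q => conj (x q))
    (Complex.continuous_conj.comp x.continuous) (fun _ _ => rfl)
  rw [hunf] at h0
  rw [← h0]
  congr 1
  ext g
  congr 1
  rw [← integral_conj]
  congr 1
  ext t
  rw [map_mul, conj_wt_star, MulAction.Quotient.smul_mk, smul_eq_mul, mul_inv_rev]
  rfl

/-- The same with the translate written as `x(h⁻¹ • π (jT t)⁻¹)`. [folklore] -/
theorem toricCoeff_eq_zero_of_orthogonal_EisL2_smul {μ : Measure G} (hM : IsCocompactHaarModel Γ μQ μ)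
    (hΓ : DiscreteMeets Γ) (x : C(G ⧸ Γ, ℂ))
    (horth : ∀ f : C_c(G, ℂ), ⟪EisL2 μQ ν jT β χ hΓ f, ContinuousMap.toLp (E := ℂ) 2 μQ ℂ x⟫_ℂ = 0) (h : G) :
    ∫ t, wt β (star χ) t * x (h⁻¹ • QuotientGroup.mk (jT t)⁻¹) ∂ν = 0 := by
  have := toricCoeff_eq_zero_of_orthogonal_EisL2 ν jT β χ hM hΓ x horth h
  simpa only [MulAction.Quotient.smul_mk, smul_eq_mul, mul_inv_rev] using this

/-- **Any period model.** If a functional `P` on `C(G ⧸ Γ, ℂ)` IS the `β conj χ`-weighted toric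
period (e.g. `P = toricPeriodCLM ν _ _ _`), then `x ⟂` every `E^χ_f` forces `P` to kill every
translate `x(h⁻¹ • ·)` of `x`. [folklore] -/
theorem unfold_of_periodModel {μ : Measure G} (hM : IsCocompactHaarModel Γ μQ μ) (hΓ : DiscreteMeets Γ)
    (P : C(G ⧸ Γ, ℂ) → ℂ)
    (hP : ∀ y : C(G ⧸ Γ, ℂ), P y = ∫ t, wt β (star χ) t * y (QuotientGroup.mk (jT t)⁻¹) ∂ν)
    (transl : G → C(G ⧸ Γ, ℂ) → C(G ⧸ Γ, ℂ)) (htransl : ∀ h y q, transl h y q = y (h⁻¹ • q))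
    (x : C(G ⧸ Γ, ℂ))
    (horth : ∀ f : C_c(G, ℂ), ⟪EisL2 μQ ν jT β χ hΓ f, ContinuousMap.toLp (E := ℂ) 2 μQ ℂ x⟫_ℂ = 0) (h : G) :
    P (transl h x) = 0 := by
  rw [hP]
  simp only [htransl]
  exact toricCoeff_eq_zero_of_orthogonal_EisL2_smul ν jT β χ hM hΓ x horth h

/-- The canonical period model: `toricPeriodCLM` with `w = β conj χ`, `pt = π ∘ inv ∘ jT`.
[folklore] -/
theorem toricPeriodCLM_transl_eq_zero {μ : Measure G} (hM : IsCocompactHaarModel Γ μQ μ) (hΓ : DiscreteMeets Γ)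
    (transl : G → C(G ⧸ Γ, ℂ) → C(G ⧸ Γ, ℂ)) (htransl : ∀ h y q, transl h y q = y (h⁻¹ • q))
    (x : C(G ⧸ Γ, ℂ))
    (horth : ∀ f : C_c(G, ℂ), ⟪EisL2 μQ ν jT β χ hΓ f, ContinuousMap.toLp (E := ℂ) 2 μQ ℂ x⟫_ℂ = 0) (h : G) :
    toricPeriodCLM ν (continuous_wt_star β χ) (hasCompactSupport_wt_star β χ)
        (QuotientGroup.continuous_mk.comp (continuous_inv.comp jT.continuous) :
          Continuous fun t : T => (QuotientGroup.mk (jT t)⁻¹ : G ⧸ Γ))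
        (transl h x) = 0 :=
  unfold_of_periodModel ν jT β χ hM hΓ _ (fun y => toricPeriodCLM_apply ν _ _ _ y) transl htransl x horth h


end Unfold

end RegularRep

end Literature.NumberTheory.Automorphic

end
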